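import Summits.KontsevichZagierPeriods.KontsevichZagierPeriods.Theses.FurushoPentagon
import Summits.KontsevichZagierPeriods.KontsevichZagierPeriods.Theorems.StuffleInKZ.Negative.Core
import Literature.NumberTheory.Transcendental.KZRulesAssociator
import Literature.NumberTheory.Transcendental.KZProductIdeal

/-!
# Crux-triage r1-1 checks — crux `SectorToKernel` (stmt-KontsevichZagierPeriods-10813)

Kernel-checked observations used in `TRIAGE-r1-1.md` (triager 1 of 3). Nothing here is proposed
to the gate; everything is `sorry`-free.

* §1 cards `prime-relations-formal-dimension` / `fraction-field-genericity`: their transcendence-free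
  conjuncts `PrimeRelations` / `IsDomainModRel` are ONE Prop (`Iff.rfl`) — same lever.
* §2 card `fraction-field-genericity`: the leaf `GenericEval` is, verbatim up to a redundant disjunct,
  "every vanishing combination is annihilated modulo the moves by SOME non-relation"
  (`genericEval_iff_annihilated`), and it is implied by route AyoubSpecialisation's `KZ.PiLocalKernel`
  (stmt-0541) (`genericEval_of_piLocalKernel`) — so the card's claim "the transcendence clause drops
  below 'injective on P[1/π]'" is correct: `K ⇒ PiLocalKernel ⇒ GenericEval`.
* §3 card `mzv-oracle-residual`: its conjunct `OffSectorResidual` is exactly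
  `ker eval ≤ relations ⊔ mzvSpan` (`offSectorResidual_iff`) — the kernel form modulo the countably
  generated subgroup of MZV simplex classes.
-/

noncomputable section

set_option linter.dupNamespace false

namespace Summit.KontsevichZagierPeriods.KontsevichZagierPeriods.Cruxes.SectorToKernel.Triage1

open Literature.NumberTheory.Transcendental Literature.NumberTheory.Transcendental.KZ
open Summit.KontsevichZagierPeriods.KontsevichZagierPeriods.Theses.FurushoPentagon
open Summit.KontsevichZagierPeriods.Theorems.StuffleInKZ.Negative (of_unit_not_mem_relations)

/-! ## §1 Cards 4 and 5 share their transcendence-free conjunct verbatim -/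

/-- Card `fraction-field-genericity`. -/
def IsDomainModRel : Prop :=
  ∀ x y : FormalRep, x * y ∈ relations → x ∈ relations ∨ y ∈ relations

/-- Card `prime-relations-formal-dimension`. -/
def PrimeRelations : Prop :=
  ∀ a b : FormalRep, a * b ∈ relations → a ∈ relations ∨ b ∈ relations

theorem primeRelations_iff_isDomainModRel : PrimeRelations ↔ IsDomainModRel := Iff.rfl

/-! ## §2 `GenericEval` = annihilation by a non-relation; implied by `PiLocalKernel` -/

/-- Card `fraction-field-genericity`, verbatim. -/
def GenericEval : Prop :=
  ∀ x : FormalRep, eval x = 0 → x ∈ relations ∨ ∃ y : FormalRep, y ∉ relations ∧ x * y ∈ relations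

/-- The first disjunct is redundant (`x ∈ relations ⇒ x * [pt,1] ∈ relations`, `[pt,1] ∉ relations`). -/
theorem genericEval_iff_annihilated :
    GenericEval ↔ ∀ x : FormalRep, eval x = 0 → ∃ y : FormalRep, y ∉ relations ∧ x * y ∈ relations := by
  constructor
  · intro h x hx
    rcases h x hx with hx' | hx'
    · exact ⟨of IntegralRep.unit, of_unit_not_mem_relations, mul_mem_relations_right_holds _ _ hx'⟩
    · exact hx'
  · intro h x hx
    exact Or.inr (h x hx)

/-- Right-nested powers of `[π]` applied to the unit: `[π] * ([π] * (… * [pt,1]))`. -/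
def piPow (N : ℕ) : FormalRep := (fun z => of piRep * z)^[N] (of IntegralRep.unit)

theorem eval_piPow (N : ℕ) : eval (piPow N) = Real.pi ^ N := by
  induction N with
  | zero => simp [piPow, IntegralRep.value_unit]
  | succ N ih =>
    simp only [piPow, Function.iterate_succ_apply'] at ih ⊢
    rw [eval_mul', eval_of_piRep, ih, pow_succ, mul_comm]

theorem piPow_not_mem_relations (N : ℕ) : piPow N ∉ relations := by
  intro h
  have h0 : eval (piPow N) = 0 := relations_le_ker_eval_holds h
  rw [eval_piPow] at h0
  exact pow_ne_zero N Real.pi_ne_zero h0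

/-- `(p * ·)^[N] x ≡ x * piPow N` modulo relations (associativity, commutativity, unit law mod relations). -/
theorem iterate_sub_mul_piPow_mem (N : ℕ) (x : FormalRep) :
    (fun z => of piRep * z)^[N] x - x * piPow N ∈ relations := by
  induction N with
  | zero =>
    simp only [piPow, Function.iterate_zero, id_eq]
    have := mul_of_unit_sub_mem_relations x
    have h := relations.neg_mem this
    rwa [neg_sub] at h
  | succ N ih =>
    simp only [Function.iterate_succ_apply', piPow] at ih ⊢
    set q : FormalRep := (fun z => of piRep * z)^[N] (of IntegralRep.unit) with hq
    set t : FormalRep := (fun z => of piRep * z)^[N] x with ht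
    -- p * t - x * (p * q) = p * (t - x * q) + (p * (x * q) - (p * x) * q) + ((p * x) * q - (x * p) * q)
    --                      + ((x * p) * q - x * (p * q))
    have h1 : of piRep * (t - x * q) ∈ relations := mul_mem_relations_left_holds _ _ ih
    have h2 : of piRep * (x * q) - of piRep * x * q ∈ relations := by
      have := mul_assoc_sub_mem_relations (of piRep) x q
      have h := relations.neg_mem this
      rwa [neg_sub] at h
    have h3 : of piRep * x * q - x * of piRep * q ∈ relations := by
      have := mul_mem_relations_right_holds _ q (mul_sub_mul_comm_mem_relations (of piRep) x)
      rwa [sub_mul] at this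
    have h4 : x * of piRep * q - x * (of piRep * q) ∈ relations := mul_assoc_sub_mem_relations x (of piRep) q
    have hsum := relations.add_mem (relations.add_mem (relations.add_mem h1 h2) h3) h4
    have : of piRep * t - x * (of piRep * q) =
        of piRep * (t - x * q) + (of piRep * (x * q) - of piRep * x * q) +
          (of piRep * x * q - x * of piRep * q) + (x * of piRep * q - x * (of piRep * q)) := by
      rw [mul_sub]; abel
    rw [this]
    exact hsum

/-- **`PiLocalKernel ⇒ GenericEval`** (multiplier `piPow N`). -/
theorem genericEval_of_piLocalKernel (h : PiLocalKernel) : GenericEval := by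
  rw [genericEval_iff_annihilated]
  intro x hx
  obtain ⟨N, hN⟩ := h x hx
  refine ⟨piPow N, piPow_not_mem_relations N, ?_⟩
  have := relations.sub_mem hN (iterate_sub_mul_piPow_mem N x)
  simpa using this

/-- And the kernel form gives `GenericEval` (first disjunct). -/
theorem genericEval_of_kernel (h : ∀ c : FormalRep, eval c = 0 → c ∈ relations) : GenericEval :=
  fun x hx => Or.inl (h x hx)

/-! ## §3 Card 2's residual is the kernel form modulo the MZV span -/

/-- The MZV simplex generators (card `mzv-oracle-residual`, verbatim). -/
def mzvGen : Set FormalRep :=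
  {x | ∃ (u : List ℕ) (hu : MZV.IsAdmissible u),
    x = of (mzvRep u hu (mzvIntegrand_isSemialgebraicFunOn_holds u) (mzvIntegrand_integrableOn_holds u hu))}

/-- Their span. -/
def mzvSpan : AddSubgroup FormalRep := AddSubgroup.closure mzvGen

/-- Card 2's conjunct B, verbatim. -/
def OffSectorResidual : Prop := ∀ c : FormalRep, eval c = 0 → ∃ c' ∈ mzvSpan, c - c' ∈ relations

/-- **B is `ker eval ≤ relations ⊔ mzvSpan`.** -/
theorem offSectorResidual_iff : OffSectorResidual ↔ eval.ker ≤ relations ⊔ mzvSpan := by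
  constructor
  · intro h c hc
    obtain ⟨c', hc', hcc'⟩ := h c hc
    have : c = (c - c') + c' := by abel
    rw [this]
    exact AddSubgroup.add_mem _ (AddSubgroup.mem_sup_left hcc') (AddSubgroup.mem_sup_right hc')
  · intro h c hc
    have hc' : c ∈ relations ⊔ mzvSpan := h (by simpa using hc)
    obtain ⟨a, ha, b, hb, hab⟩ := AddSubgroup.mem_sup.mp hc'
    refine ⟨b, hb, ?_⟩
    have : c - b = a := by rw [← hab]; abel
    rw [this]
    exact ha

/-- The kernel form is `B` plus the MZV-span kernel (card 2's split, hypothesis-free form). -/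
theorem kernel_iff_residual_and_mzvKernel :
    (∀ c : FormalRep, eval c = 0 → c ∈ relations) ↔
      (OffSectorResidual ∧ ∀ c ∈ mzvSpan, eval c = 0 → c ∈ relations) := by
  constructor
  · intro h
    exact ⟨fun c hc => ⟨0, mzvSpan.zero_mem, by simpa using h c hc⟩, fun c _ hc => h c hc⟩
  · rintro ⟨hB, hA⟩ c hc
    obtain ⟨c', hc', hcc'⟩ := hB c hc
    have h0 : eval c' = 0 := by
      have := relations_le_ker_eval_holds hcc'
      rw [AddMonoidHom.mem_ker, map_sub, hc, zero_sub, neg_eq_zero] at this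
      exact this
    have := relations.add_mem hcc' (hA c' hc' h0)
    simpa using this

end Summit.KontsevichZagierPeriods.KontsevichZagierPeriods.Cruxes.SectorToKernel.Triage1
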